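import Mathlib
import HarnessLib
import Summits.Ventures.LatticeQCDFlow.Scaling.AutoregressiveRingPath
import Summits.Ventures.LatticeQCDFlow.Scaling.KernelMarginalSMTP2

/-!
# LatticeQCDFlow / Scaling — THE RING IS FAITHFUL: on the periodic nearest-neighbour chain the exact
# autoregressive conditional of site `k` reads the far end of the chain THROUGH the integrated block
# (C5: the fill edge of the elimination graph is read)

HONEST FRAMING: exact (Metropolis-corrected) sampling algorithms for lattice gauge theory;
figures of merit are autocorrelation/cost numbers at stated couplings and volumes; no
continuum-physics claim.

Venture `LatticeQCDFlow` (cell pub-lqcd), topic `Scaling`, FANOUT row 30 (lean-1, GEN-17) — OUR WORK on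
THEORY-2.md §4 conjecture C5 ("the exact KR map has EXACTLY the symbolic sparsity"), the capstone of
`KernelCompositionTP2` → `AutoregressivePathFaithful` → `AutoregressiveRingPath`:

* §1 **`ring_arConditional_reads_last`** — the ring `ℤ/(n+2)` (sites `Fin (n+2)`; chain bonds `b_l`
  between `l` and `l+1`, closing bond `bc` between the last site `n+1` and `0`, site factors `g_i`;
  everything positive bounded measurable, the bonds STRICTLY TP₂ for the linear order of `X`; any
  reference probability measure with `0 < (μ ⊗ μ){x < y}`; generate from the top, `s = {i | i < k}`
  integrated): for every `k ≤ n − 1` the exact conditional of site `k` given the sites above it READS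
  the last site — bonded to `k` only through the integrated block `{0, …, k−1}` and the closing bond
  (directly for `k = 0`).  Together with the direct neighbour `k+1` (GEN-16's bond theorem
  `arConditional_reads_bond` applies to the same sorting, the closing bond sitting in the blind factor)
  and the frontier bound of `Scaling/AutoregressiveMarkovContext` (nothing outside the fill-neighbourhood
  is read) — both routine instantiations, not repeated here — the context of site `k` on the ring is
  exactly `{k+1, n+1}`: strictly larger than the interaction neighbourhood seen from the retained side.
* §2 **`gaussianRing_arConditional_reads_last`** — the Gaussian / gradient-`φ⁴` ring (`X = ℝ`, all
  bonds `exp(−κ(u−t)²/2)` with `κ > 0` — strictly TP₂, `KernelMarginalSMTP2.gaussianBond_stp2` —, arbitrary positive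
  bounded measurable site factors, any reference probability measure charging `(−∞,c)` and `(c,∞)`).

READING (value-free, C5): the first lattice geometry where the true autoregressive context is
STRICTLY LARGER than the interaction neighbourhood and EQUAL to the symbolic (fill-in) context, as a
theorem, for every ferromagnetic (TP₂) nearest-neighbour pair interaction with arbitrary one-body
terms and every non-degenerate reference measure.  NOT CLAIMED: `d ≥ 2` (multivariate total
positivity needed); non-TP₂ bonds (XY spins, gauge links — where GEN-15/16 show the symbolic context is
NOT attained); any number of ours.  Elementary over the parents; no `def`; nothing is cited as a
fact; no `sorry`.
-/

noncomputable section

namespace Summit.Ventures.LatticeQCDFlow.Theory2.Autoregressive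

open MeasureTheory Function Set
open Summit.Ventures.LatticeQCDFlow.Exactness

variable {X : Type*} [MeasurableSpace X]
variable (μ : Measure X) [IsProbabilityMeasure μ]

/-! ## §1 The ring theorem -/

section Ring

variable {n : ℕ} (g : Fin (n + 2) → X → ℝ) (b : Fin (n + 1) → X → X → ℝ) (bc : X → X → ℝ)

/-- **THE RING IS FAITHFUL THROUGH THE BLOCK: the exact autoregressive conditional of site `k` reads
the last site.**  Ring `ℤ/(n+2)` with positive bounded measurable site factors `g_i`, chain bonds `b_l`
(between `l` and `l+1`) and closing bond `bc` (between the last site and `0`), the bonds strictly TP₂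
for the linear order of `X`; reference probability measure with `0 < (μ ⊗ μ){x < y}`; generate from
the top, `s = {i | i < k}` integrated, `k + 1 < n + 1`.  Then there are two configurations agreeing
off the last site on which `A_s w / A_{insert k s} w` differs: the last site — bonded to `k` only
through the integrated block and the closing bond — IS READ. [ours] -/
theorem ring_arConditional_reads_last [LinearOrder X] (hgm : ∀ i, Measurable (g i))
    (hbm : ∀ l, Measurable (uncurry (b l))) (hbcm : Measurable (uncurry bc))
    (hgpos : ∀ i v, 0 < g i v) (hbpos : ∀ l v v', 0 < b l v v') (hbcpos : ∀ v v', 0 < bc v v')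
    (hgbdd : ∀ i, ∃ C, ∀ v, g i v ≤ C) (hbbdd : ∀ l, ∃ C, ∀ v v', b l v v' ≤ C)
    (hbcbdd : ∃ C, ∀ v v', bc v v' ≤ C)
    (hbs : ∀ l u u' x y, u < u' → x < y → b l u y * b l u' x < b l u x * b l u' y)
    (hbcs : ∀ u u' x y, u < u' → x < y → bc u y * bc u' x < bc u x * bc u' y)
    (hμ : 0 < (μ.prod μ) {p : X × X | p.1 < p.2}) (k : Fin (n + 1)) (hk : k.val < n) :
    ∃ ψ ψ' : Fin (n + 2) → X, (∀ i, i ≠ Fin.last (n + 1) → ψ i = ψ' i) ∧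
      coordAvg μ (Finset.univ.filter (· < k.castSucc))
            (fun φ => (∏ i, g i (φ i)) * (∏ l : Fin (n + 1), b l (φ l.castSucc) (φ l.succ)) *
              bc (φ (Fin.last (n + 1))) (φ 0)) ψ /
          coordAvg μ (insert k.castSucc (Finset.univ.filter (· < k.castSucc)))
            (fun φ => (∏ i, g i (φ i)) * (∏ l : Fin (n + 1), b l (φ l.castSucc) (φ l.succ)) *
              bc (φ (Fin.last (n + 1))) (φ 0)) ψ ≠
        coordAvg μ (Finset.univ.filter (· < k.castSucc))
            (fun φ => (∏ i, g i (φ i)) * (∏ l : Fin (n + 1), b l (φ l.castSucc) (φ l.succ)) *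
              bc (φ (Fin.last (n + 1))) (φ 0)) ψ' /
          coordAvg μ (insert k.castSucc (Finset.univ.filter (· < k.castSucc)))
            (fun φ => (∏ i, g i (φ i)) * (∏ l : Fin (n + 1), b l (φ l.castSucc) (φ l.succ)) *
              bc (φ (Fin.last (n + 1))) (φ 0)) ψ' := by
  classical
  -- names
  set m : ℕ := k.val with hmdef
  have hm2 : m ≤ n + 2 := by omega
  set a : Fin (n + 2) := k.castSucc with hadef
  have ha_eq : a = ⟨m, by omega⟩ := Fin.ext (by simp [hadef, hmdef])
  set j : Fin (n + 2) := Fin.last (n + 1) with hjdef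
  set s : Finset (Fin (n + 2)) := Finset.univ.filter (· < a) with hsdef
  have hmem_s : ∀ i : Fin (n + 2), i ∈ s ↔ i.val < m := by
    intro i; simp [hsdef, Fin.lt_def, ha_eq]
  let nF : Fin (n + 1) := ⟨n, by omega⟩
  -- the sorting `w = f₀ · w₁ · w₂`
  let w₁ : (Fin (n + 2) → X) → ℝ := fun η =>
    (∏ i ∈ Finset.univ.filter (fun i : Fin (n + 2) => m ≤ i.val ∧ i.val ≤ n), g i (η i)) *
      ∏ l ∈ Finset.univ.filter (fun l : Fin (n + 1) => m ≤ l.val ∧ l.val < n),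
        b l (η l.castSucc) (η l.succ)
  let w₂ : (Fin (n + 2) → X) → ℝ := fun η => g j (η j) * b nF (η nF.castSucc) (η nF.succ)
  have hsite : ∀ η : Fin (n + 2) → X, ∏ i, g i (η i) =
      (∏ i ∈ Finset.univ.filter (fun i : Fin (n + 2) => i.val < m), g i (η i)) *
        (∏ i ∈ Finset.univ.filter (fun i : Fin (n + 2) => m ≤ i.val ∧ i.val ≤ n), g i (η i)) *
        g j (η j) := by
    intro η
    rw [← Finset.prod_filter_mul_prod_filter_not Finset.univ (fun i : Fin (n + 2) => i.val < m),
      ← Finset.prod_filter_mul_prod_filter_not (Finset.univ.filter fun i : Fin (n + 2) => ¬ i.val < m)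
        (fun i : Fin (n + 2) => i.val ≤ n), Finset.filter_filter, Finset.filter_filter, mul_assoc]
    congr 2
    · refine Finset.prod_congr (Finset.filter_congr fun i _ => ?_) fun _ _ => rfl
      omega
    · have : Finset.univ.filter (fun i : Fin (n + 2) => ¬ i.val < m ∧ ¬ i.val ≤ n) = {j} := by
        ext i
        simp only [Finset.mem_filter, Finset.mem_univ, true_and, Finset.mem_singleton, Fin.ext_iff,
          hjdef, Fin.val_last]
        omega
      rw [this, Finset.prod_singleton]
  have hbond : ∀ η : Fin (n + 2) → X, ∏ l : Fin (n + 1), b l (η l.castSucc) (η l.succ) =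
      (∏ l ∈ Finset.univ.filter (fun l : Fin (n + 1) => l.val < m), b l (η l.castSucc) (η l.succ)) *
        (∏ l ∈ Finset.univ.filter (fun l : Fin (n + 1) => m ≤ l.val ∧ l.val < n),
          b l (η l.castSucc) (η l.succ)) *
        b nF (η nF.castSucc) (η nF.succ) := by
    intro η
    rw [← Finset.prod_filter_mul_prod_filter_not Finset.univ (fun l : Fin (n + 1) => l.val < m),
      ← Finset.prod_filter_mul_prod_filter_not (Finset.univ.filter fun l : Fin (n + 1) => ¬ l.val < m)
        (fun l : Fin (n + 1) => l.val < n), Finset.filter_filter, Finset.filter_filter, mul_assoc]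
    congr 2
    · refine Finset.prod_congr (Finset.filter_congr fun i _ => ?_) fun _ _ => rfl
      omega
    · have : Finset.univ.filter (fun l : Fin (n + 1) => ¬ l.val < m ∧ ¬ l.val < n) = {nF} := by
        ext l
        simp only [Finset.mem_filter, Finset.mem_univ, true_and, Finset.mem_singleton, Fin.ext_iff, nF]
        omega
      rw [this, Finset.prod_singleton]
  have hsplit : (fun φ : Fin (n + 2) → X => (∏ i, g i (φ i)) *
      (∏ l : Fin (n + 1), b l (φ l.castSucc) (φ l.succ)) * bc (φ (Fin.last (n + 1))) (φ 0)) =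
      fun η => pathFactor (ringDown b bc a) (ringPath g b bc m hm2) j (η a) η * w₁ η * w₂ η := by
    funext η
    rw [ha_eq, pathFactor_ringPath g b bc m (by omega) η, hsite, hbond]
    simp only [w₁, w₂, hjdef]
    ring
  rw [hsplit]
  -- hypotheses of §1
  have has : a ∉ s := by simp [hsdef]
  have hjs : j ∉ s := by rw [hmem_s]; simp [hjdef]; omega
  have hja : j ≠ a := by rw [ha_eq, hjdef]; simp [Fin.ext_iff]; omega
  have hps : ∀ p ∈ (ringPath g b bc m hm2).map Prod.fst, p ∈ s := fun p hp =>
    (hmem_s p).2 ((mem_ringPath_sites_iff g b bc m hm2 p).1 hp)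
  have hw₁ : DependsOn w₁ {i : Fin (n + 2) | m ≤ i.val ∧ i.val ≤ n} := by
    intro η η' h
    simp only [w₁]
    congr 1
    · exact Finset.prod_congr rfl fun i hi => by rw [h i (by simpa using hi)]
    · refine Finset.prod_congr rfl fun l hl => ?_
      have hl' : m ≤ l.val ∧ l.val < n := by simpa using hl
      rw [h l.castSucc (by simp; omega), h l.succ (by simp; omega)]
  have hjV₁ : j ∉ {i : Fin (n + 2) | m ≤ i.val ∧ i.val ≤ n} := by simp [hjdef]
  have hTV₁ : ∀ p ∈ (ringPath g b bc m hm2).map Prod.fst, p ∉ {i : Fin (n + 2) | m ≤ i.val ∧ i.val ≤ n} := by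
    intro p hp
    have := (mem_ringPath_sites_iff g b bc m hm2 p).1 hp
    simp; omega
  have hw₂ : DependsOn w₂ {nF.castSucc, j} := by
    intro η η' h
    simp only [w₂]
    have h1 : η j = η' j := h j (by simp)
    have h2 : η nF.castSucc = η' nF.castSucc := h _ (by simp)
    have h3 : nF.succ = j := Fin.ext (by simp [nF, hjdef])
    rw [h3, h1, h2]
  have haV₂ : a ∉ ({nF.castSucc, j} : Set (Fin (n + 2))) := by
    rw [ha_eq]; simp [Fin.ext_iff, nF, hjdef]; omega
  have hsV₂ : ∀ i ∈ s, i ∉ ({nF.castSucc, j} : Set (Fin (n + 2))) := by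
    intro i hi
    have := (hmem_s i).1 hi
    simp [Fin.ext_iff, nF, hjdef]; omega
  -- positivity, measurability, bounds
  have hw₁pos : ∀ η, 0 < w₁ η := fun η =>
    mul_pos (Finset.prod_pos fun i _ => hgpos i _) (Finset.prod_pos fun l _ => hbpos l _ _)
  have hw₂pos : ∀ η, 0 < w₂ η := fun η => mul_pos (hgpos _ _) (hbpos _ _ _)
  have hgm' : ∀ i, Measurable fun η : Fin (n + 2) → X => g i (η i) :=
    fun i => (hgm i).comp (measurable_pi_apply i)
  have hbm' : ∀ l : Fin (n + 1),
      Measurable fun η : Fin (n + 2) → X => b l (η l.castSucc) (η l.succ) := fun l =>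
    show Measurable (uncurry (b l) ∘ fun η : Fin (n + 2) → X => (η l.castSucc, η l.succ)) from
      (hbm l).comp ((measurable_pi_apply _).prodMk (measurable_pi_apply _))
  have hw₁m : Measurable w₁ :=
    (Finset.measurable_prod _ fun i _ => hgm' i).mul (Finset.measurable_prod _ fun l _ => hbm' l)
  have hRD := ringDown_props b bc hbm hbcm hbpos hbcpos hbbdd hbcbdd hbs hbcs
  choose Cg hCg using hgbdd
  choose Cb hCb using hbbdd
  obtain ⟨Cc, hCc⟩ := hbcbdd
  have hint : ∀ (t : Finset (Fin (n + 2))) (φ : Fin (n + 2) → X) {W : (Fin (n + 2) → X) → ℝ},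
      Measurable W → (∀ η, 0 < W η) → (∃ C, ∀ η, W η ≤ C) →
        Integrable (fun η : Fin (n + 2) → X => W (t.piecewise η φ)) (Measure.pi fun _ => μ) := by
    intro t φ W hWm hWpos hWC
    obtain ⟨C, hC⟩ := hWC
    refine Integrable.mono' (integrable_const C)
      ((hWm.comp (measurable_piecewise_left t φ)).aestronglyMeasurable) (ae_of_all _ fun η => ?_)
    rw [Real.norm_eq_abs, abs_of_pos (hWpos _)]
    exact hC _
  have hw₁bdd : ∃ C, ∀ η, w₁ η ≤ C := by
    refine ⟨(∏ i ∈ Finset.univ.filter (fun i : Fin (n + 2) => m ≤ i.val ∧ i.val ≤ n), Cg i) *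
      ∏ l ∈ Finset.univ.filter (fun l : Fin (n + 1) => m ≤ l.val ∧ l.val < n), Cb l, fun η => ?_⟩
    exact mul_le_mul (Finset.prod_le_prod (fun i _ => (hgpos i _).le) fun i _ => hCg i _)
      (Finset.prod_le_prod (fun l _ => (hbpos l _ _).le) fun l _ => hCb l _ _)
      (Finset.prod_nonneg fun l _ => (hbpos l _ _).le)
      (Finset.prod_nonneg fun i _ => le_trans (hgpos i (η i)).le (hCg i _))
  have hG : ∀ ψ, coordAvg μ s w₁ ψ ≠ 0 := fun ψ =>
    (coordAvg_pos_of_pos μ _ hw₁pos ψ (hint _ ψ hw₁m hw₁pos hw₁bdd)).ne'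
  -- the full weight is positive bounded measurable
  have hWm : Measurable fun η : Fin (n + 2) → X =>
      pathFactor (ringDown b bc a) (ringPath g b bc m hm2) j (η a) η * w₁ η * w₂ η := by
    rw [← hsplit]
    have hbc' : Measurable fun η : Fin (n + 2) → X => bc (η (Fin.last (n + 1))) (η 0) :=
      show Measurable (uncurry bc ∘ fun η : Fin (n + 2) → X => (η (Fin.last (n + 1)), η 0)) from
        hbcm.comp ((measurable_pi_apply _).prodMk (measurable_pi_apply _))
    exact ((Finset.measurable_prod _ fun i _ => hgm' i).mul
      (Finset.measurable_prod _ fun l _ => hbm' l)).mul hbc'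
  have hWpos : ∀ η : Fin (n + 2) → X,
      0 < pathFactor (ringDown b bc a) (ringPath g b bc m hm2) j (η a) η * w₁ η * w₂ η := by
    intro η
    rw [← congrFun hsplit η]
    exact mul_pos (mul_pos (Finset.prod_pos fun i _ => hgpos i _)
      (Finset.prod_pos fun l _ => hbpos l _ _)) (hbcpos _ _)
  have hWbdd : ∃ C, ∀ η : Fin (n + 2) → X,
      pathFactor (ringDown b bc a) (ringPath g b bc m hm2) j (η a) η * w₁ η * w₂ η ≤ C := by
    refine ⟨(∏ i, Cg i) * (∏ l, Cb l) * Cc, fun η => ?_⟩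
    rw [← congrFun hsplit η]
    have h1 : ∏ i, g i (η i) ≤ ∏ i, Cg i :=
      Finset.prod_le_prod (fun i _ => (hgpos i _).le) fun i _ => hCg i _
    have h2 : ∏ l : Fin (n + 1), b l (η l.castSucc) (η l.succ) ≤ ∏ l, Cb l :=
      Finset.prod_le_prod (fun l _ => (hbpos l _ _).le) fun l _ => hCb l _ _
    have h0 : 0 ≤ ∏ i, Cg i := Finset.prod_nonneg fun i _ => le_trans (hgpos i (η i)).le (hCg i _)
    exact mul_le_mul (mul_le_mul h1 h2 (Finset.prod_nonneg fun l _ => (hbpos l _ _).le) h0)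
      (hCc _ _) (hbcpos _ _).le (mul_nonneg h0 (Finset.prod_nonneg fun l _ =>
        le_trans (hbpos l (η l.castSucc) (η l.succ)).le (hCb l _ _)))
  have hM : ∀ ψ, coordAvg μ (insert a s) (fun η =>
      pathFactor (ringDown b bc a) (ringPath g b bc m hm2) j (η a) η * w₁ η * w₂ η) ψ ≠ 0 := fun ψ =>
    (coordAvg_pos_of_pos μ _ hWpos ψ (hint _ ψ hWm hWpos hWbdd)).ne'
  -- the path data
  have hg_path : ∀ pgb ∈ ringPath g b bc m hm2,
      (∀ x, 0 < pgb.2.1 x) ∧ Measurable pgb.2.1 ∧ ∃ C, ∀ x, |pgb.2.1 x| ≤ C := by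
    intro pgb hp
    obtain ⟨i, -, rfl⟩ := (mem_ringPath_iff g b bc m hm2 pgb).1 hp
    exact ⟨hgpos i, hgm i, Cg i, fun x => by rw [abs_of_pos (hgpos i x)]; exact hCg i x⟩
  have hb_path : ∀ pgb ∈ ringPath g b bc m hm2,
      (∀ x t, 0 < pgb.2.2 x t) ∧ Measurable (uncurry pgb.2.2) ∧ (∃ C, ∀ x t, |pgb.2.2 x t| ≤ C) ∧
      ∀ x y t t', x < y → t < t' →
        pgb.2.2 x t' * pgb.2.2 y t < pgb.2.2 x t * pgb.2.2 y t' := by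
    intro pgb hp
    obtain ⟨i, -, rfl⟩ := (mem_ringPath_iff g b bc m hm2 pgb).1 hp
    exact hRD i
  obtain ⟨hFp, hFm, hFb, hFs⟩ := hRD a
  exact arConditional_reads_through_path μ s has hjs hja (ringDown b bc a) (ringPath g b bc m hm2)
    (ringPath_sites_nodup g b bc m hm2) hps hw₁ hjV₁ hTV₁ hw₂ haV₂ hsV₂ (fun ψ => (hw₂pos ψ).ne')
    hG hM hμ hFp hFm hFb hFs hg_path hb_path


end Ring

/-! ## §2 The Gaussian / gradient-`φ⁴` ring -/

/-- **THE GAUSSIAN / GRADIENT-`φ⁴` RING IS FAITHFUL THROUGH THE BLOCK**: `X = ℝ`, all bonds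
`exp(−κ(u−t)²/2)` with `κ > 0`, arbitrary positive bounded measurable site factors, any reference
probability measure charging `(−∞, c)` and `(c, ∞)`; for every `k ≤ n − 1` the exact conditional of
site `k` (sites `< k` integrated) READS the last site `n + 1`. [ours] -/
theorem gaussianRing_arConditional_reads_last {n : ℕ} (ν : Measure ℝ) [IsProbabilityMeasure ν]
    (c : ℝ) (h₁ : ν (Iio c) ≠ 0) (h₂ : ν (Ioi c) ≠ 0) (g : Fin (n + 2) → ℝ → ℝ)
    (hgm : ∀ i, Measurable (g i)) (hgpos : ∀ i v, 0 < g i v) (hgbdd : ∀ i, ∃ C, ∀ v, g i v ≤ C)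
    {κ : ℝ} (hκ : 0 < κ) (k : Fin (n + 1)) (hk : k.val < n) :
    ∃ ψ ψ' : Fin (n + 2) → ℝ, (∀ i, i ≠ Fin.last (n + 1) → ψ i = ψ' i) ∧
      coordAvg ν (Finset.univ.filter (· < k.castSucc))
            (fun φ => (∏ i, g i (φ i)) *
              (∏ l : Fin (n + 1), Real.exp (-(κ * (φ l.castSucc - φ l.succ) ^ 2 / 2))) *
              Real.exp (-(κ * (φ (Fin.last (n + 1)) - φ 0) ^ 2 / 2))) ψ /
          coordAvg ν (insert k.castSucc (Finset.univ.filter (· < k.castSucc)))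
            (fun φ => (∏ i, g i (φ i)) *
              (∏ l : Fin (n + 1), Real.exp (-(κ * (φ l.castSucc - φ l.succ) ^ 2 / 2))) *
              Real.exp (-(κ * (φ (Fin.last (n + 1)) - φ 0) ^ 2 / 2))) ψ ≠
        coordAvg ν (Finset.univ.filter (· < k.castSucc))
            (fun φ => (∏ i, g i (φ i)) *
              (∏ l : Fin (n + 1), Real.exp (-(κ * (φ l.castSucc - φ l.succ) ^ 2 / 2))) *
              Real.exp (-(κ * (φ (Fin.last (n + 1)) - φ 0) ^ 2 / 2))) ψ' /
          coordAvg ν (insert k.castSucc (Finset.univ.filter (· < k.castSucc)))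
            (fun φ => (∏ i, g i (φ i)) *
              (∏ l : Fin (n + 1), Real.exp (-(κ * (φ l.castSucc - φ l.succ) ^ 2 / 2))) *
              Real.exp (-(κ * (φ (Fin.last (n + 1)) - φ 0) ^ 2 / 2))) ψ' := by
  obtain ⟨hpos, hmeas, hbd⟩ := gaussianBond_props κ hκ.le
  have hbd' : ∀ v v' : ℝ, Real.exp (-(κ * (v - v') ^ 2 / 2)) ≤ 1 := fun v v' =>
    le_trans (le_abs_self _) (hbd v v')
  exact ring_arConditional_reads_last ν g (fun _ v v' => Real.exp (-(κ * (v - v') ^ 2 / 2)))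
    (fun v v' => Real.exp (-(κ * (v - v') ^ 2 / 2))) hgm (fun _ => hmeas) hmeas hgpos
    (fun _ => hpos) hpos hgbdd (fun _ => ⟨1, hbd'⟩) ⟨1, hbd'⟩
    (fun _ u u' x y hu hxy => gaussianBond_stp2 hκ u u' x y hu hxy)
    (fun u u' x y hu hxy => gaussianBond_stp2 hκ u u' x y hu hxy) (real_prod_lt_pos ν c h₁ h₂) k hk

end Summit.Ventures.LatticeQCDFlow.Theory2.Autoregressive

end
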